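import Literature.Analysis.FluidPDE.HyperbolicConeEnergy
import Mathlib.Analysis.Calculus.FDeriv.Symmetric
import Mathlib.Analysis.InnerProductSpace.Calculus
import HarnessLib

/-!
# Uniqueness in the domain of dependence for second-order hyperbolic systems
# (variable coefficients, energy method on cones)

Let `a, bⁱ, Gⁱʲ = Gʲⁱ` (`i, j < d`) be smooth real functions on `ℝ × ℝᵈ` and consider the
second-order operator with **diagonal principal part**
`P u = a u_tt − 2 ∑ᵢ bⁱ u_ti − ∑ᵢⱼ Gⁱʲ u_ij`
acting on smooth maps `u : ℝ × ℝᵈ → F` into a real inner product space `F` (systems: `F = ℝᴺ`).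
On a cylinder `Z = [0, T] × B̄(x₁, ρ)` on which `a ≥ λ > 0` and `(Gⁱʲ) ≥ λ` (the slices `{t = const}`
are spacelike and `∂ₜ` is timelike for the Lorentzian cometric `−a τ² + 2 b·ξ τ + G ξ·ξ`), every
smooth `u` satisfying the **differential inequality** `‖P u‖ ≤ L (‖u‖ + ‖u_t‖ + ∑ᵢ ‖u_i‖)` on `Z`
with vanishing Cauchy data `u(0, ·) = u_t(0, ·) = 0` on `B̄(x₁, ρ)` vanishes on the solid cone
`{0 ≤ t ≤ T, dist(x, x₁) < ρ − c t}`, for a slope `c` depending only on the coefficients, the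
cylinder and `λ` (`VarWave.exists_slope_eq_zero_of_norm_le`).

This is the classical uniqueness theorem for the Cauchy problem of linear second-order
hyperbolic equations and systems — Hawking–Ellis 1973, §7.4, Lemma 7.4.6 / Prop. 7.4.5 (the
energy inequality (7.31) on the lens regions `𝒰₊` gives uniqueness), in the classical `C^∞` form of
John, *PDE*, Ch. 5 §3 and Racke, *Lectures on Nonlinear Evolution Equations*, Thm. 3.1 — and, via
the differential-inequality formulation, also the uniqueness mechanism for quasilinear systems such
as the reduced Einstein equations (Hawking–Ellis, Prop. 7.5.1: the difference of two solutions
solves a linear system whose right-hand side is bounded by `L (‖w‖ + ‖∂w‖)`).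

Proof: the energy density `e = ½ (a ‖u_t‖² + ∑ Gⁱʲ ⟪u_i, u_j⟫ + ‖u‖²)` and fluxes
`fᵢ = −∑ⱼ Gⁱʲ ⟪u_t, u_j⟫ − bⁱ ‖u_t‖²` satisfy the identity
`∂ₜ e + ∑ ∂ᵢ fᵢ = ⟪u_t, P u⟫ + R` with `R` quadratic in `(u, ∂u)` with coefficients `∂a, ∂b, ∂G`
(`VarWave.bulk_eq`), hence `∂ₜ e + ∑ ∂ᵢ fᵢ ≤ M e` and `|∑ νᵢ fᵢ| ≤ c e` on `Z`, and the abstract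
energy method on truncated cones of the tree (`Literature.Analysis.FluidPDE.coneEnergy_eq_zero`)
applies. Everything in this file is proved; there are no named facts.

## References

* S. W. Hawking, G. F. R. Ellis, *The large scale structure of space-time*, CUP 1973, §7.4
  (Lemma 7.4.4, Prop. 7.4.5, Lemma 7.4.6), §7.5 (Prop. 7.5.1). [HawkingEllis1973CUP]
* F. John, *Partial Differential Equations*, 4th ed., Springer 1982, Ch. 5 §3. [John1982]
* R. Racke, *Lectures on Nonlinear Evolution Equations*, 2nd ed. 2015, Ch. 3 Thm 3.1. [Racke2015]
-/

noncomputable section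

open Set Filter MeasureTheory Metric
open scoped Topology ContDiff RealInnerProductSpace

namespace Literature.Analysis.PDE

namespace VarWave

variable {d : ℕ} {F : Type*} [NormedAddCommGroup F] [InnerProductSpace ℝ F]

/-- Points of `ℝ × ℝᵈ` (local abbreviation). [folklore] -/
abbrev Pt (d : ℕ) : Type := ℝ × EuclideanSpace ℝ (Fin d)

/-- The time direction `(1, 0)`. [folklore] -/
abbrev eT : Pt d := ((1 : ℝ), (0 : EuclideanSpace ℝ (Fin d)))

/-- The spatial directions `(0, eᵢ)`. [folklore] -/
abbrev eX (i : Fin d) : Pt d := ((0 : ℝ), EuclideanSpace.single i (1 : ℝ))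

variable (u : Pt d → F)

/-- The time derivative `u_t`. [folklore] -/
def dT (p : Pt d) : F := fderiv ℝ u p eT

/-- The spatial derivatives `u_i`. [folklore] -/
def dX (i : Fin d) (p : Pt d) : F := fderiv ℝ u p (eX i)

/-- `u_tt`. [folklore] -/
def dTT (p : Pt d) : F := fderiv ℝ (dT u) p eT

/-- `u_ti = ∂ᵢ u_t`. [folklore] -/
def dTX (i : Fin d) (p : Pt d) : F := fderiv ℝ (dT u) p (eX i)

/-- `u_ij = ∂ᵢ u_j`. [folklore] -/
def dXX (i j : Fin d) (p : Pt d) : F := fderiv ℝ (dX u j) p (eX i)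

variable (a : Pt d → ℝ) (b : Fin d → Pt d → ℝ) (G : Fin d → Fin d → Pt d → ℝ)

/-- The operator `P u = a u_tt − 2 ∑ᵢ bⁱ u_ti − ∑ᵢⱼ Gⁱʲ u_ij`. [cite: HawkingEllis1973CUP, §7.4 (7.29)] -/
def op (p : Pt d) : F :=
  a p • dTT u p - (2 : ℝ) • ∑ i, b i p • dTX u i p - ∑ i, ∑ j, G i j p • dXX u i j p

/-- The energy density `e = ½ (a ‖u_t‖² + ∑ Gⁱʲ ⟪u_i, u_j⟫ + ‖u‖²)`.
[cite: HawkingEllis1973CUP, §7.4, Lemma 7.4.4 (energy tensor `S^{ab}`)] -/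
def energy (p : Pt d) : ℝ :=
  2⁻¹ * (a p * ⟪dT u p, dT u p⟫ + ∑ i, ∑ j, G i j p * ⟪dX u i p, dX u j p⟫ + ⟪u p, u p⟫)

/-- The energy fluxes `fᵢ = −∑ⱼ Gⁱʲ ⟪u_t, u_j⟫ − bⁱ ‖u_t‖²`. [cite: HawkingEllis1973CUP, §7.4] -/
def flux (i : Fin d) (p : Pt d) : ℝ :=
  -(∑ j, G i j p * ⟪dT u p, dX u j p⟫) - b i p * ⟪dT u p, dT u p⟫

/-- The remainder `R` of the energy identity (quadratic in `(u, ∂u)`, coefficients `∂a, ∂b, ∂G`).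
[folklore] -/
def rem (p : Pt d) : ℝ :=
  2⁻¹ * (fderiv ℝ a p eT * ⟪dT u p, dT u p⟫ +
      ∑ i, ∑ j, fderiv ℝ (G i j) p eT * ⟪dX u i p, dX u j p⟫) +
    ⟪u p, dT u p⟫ -
    ∑ i, ∑ j, fderiv ℝ (G i j) p (eX i) * ⟪dT u p, dX u j p⟫ -
    ∑ i, fderiv ℝ (b i) p (eX i) * ⟪dT u p, dT u p⟫

variable {u a b G}

/-! ### Smoothness -/

/-- Directional derivatives of a smooth map are smooth. [folklore] -/
theorem contDiff_fderiv_apply (hu : ContDiff ℝ ∞ u) (v : Pt d) :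
    ContDiff ℝ ∞ fun p ↦ fderiv ℝ u p v :=
  (hu.fderiv_right (m := ∞) le_rfl).clm_apply contDiff_const

/-- `u_t` is smooth. [folklore] -/
theorem contDiff_dT (hu : ContDiff ℝ ∞ u) : ContDiff ℝ ∞ (dT u) := contDiff_fderiv_apply hu _

/-- `u_i` is smooth. [folklore] -/
theorem contDiff_dX (hu : ContDiff ℝ ∞ u) (i : Fin d) : ContDiff ℝ ∞ (dX u i) :=
  contDiff_fderiv_apply hu _

/-- Second directional derivatives through `D²u`. [folklore] -/
theorem fderiv_fderiv_apply (hu : ContDiff ℝ ∞ u) (p v w : Pt d) :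
    fderiv ℝ (fun q ↦ fderiv ℝ u q v) p w = fderiv ℝ (fderiv ℝ u) p w v := by
  have hd : DifferentiableAt ℝ (fderiv ℝ u) p :=
    ((hu.fderiv_right (m := ∞) le_rfl).differentiable (by simp)) p
  rw [fderiv_clm_apply hd (differentiableAt_const v)]
  simp

/-- Symmetry of second derivatives. [folklore] -/
theorem fderiv_fderiv_comm (hu : ContDiff ℝ ∞ u) (p v w : Pt d) :
    fderiv ℝ (fun q ↦ fderiv ℝ u q v) p w = fderiv ℝ (fun q ↦ fderiv ℝ u q w) p v := by
  rw [fderiv_fderiv_apply hu, fderiv_fderiv_apply hu]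
  exact (hu.contDiffAt.isSymmSndFDerivAt
    (by simp only [minSmoothness_of_isRCLikeNormedField]; exact WithTop.coe_le_coe.mpr le_top)) w v

/-- `∂ₜ u_i = u_ti`. [folklore] -/
theorem fderiv_dX_eT (hu : ContDiff ℝ ∞ u) (i : Fin d) (p : Pt d) :
    fderiv ℝ (dX u i) p eT = dTX u i p :=
  fderiv_fderiv_comm hu p _ _

/-- `∂ᵢ u_j = ∂ⱼ u_i`. [folklore] -/
theorem dXX_comm (hu : ContDiff ℝ ∞ u) (i j : Fin d) (p : Pt d) : dXX u i j p = dXX u j i p :=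
  fderiv_fderiv_comm hu p _ _

/-! ### The energy identity -/

/-- Derivative of a term `c ⟪f, g⟫`. [folklore] -/
theorem fderiv_coef_inner_apply {c : Pt d → ℝ} {f g : Pt d → F} {p : Pt d}
    (hc : DifferentiableAt ℝ c p) (hf : DifferentiableAt ℝ f p) (hg : DifferentiableAt ℝ g p)
    (v : Pt d) :
    fderiv ℝ (fun q ↦ c q * ⟪f q, g q⟫) p v =
      fderiv ℝ c p v * ⟪f p, g p⟫ + c p * (⟪fderiv ℝ f p v, g p⟫ + ⟪f p, fderiv ℝ g p v⟫) := by
  have h : HasFDerivAt (fun q ↦ c q * ⟪f q, g q⟫)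
      (c p • ((fderivInnerCLM ℝ (f p, g p)).comp ((fderiv ℝ f p).prod (fderiv ℝ g p))) +
        ⟪f p, g p⟫ • fderiv ℝ c p) p :=
    hc.hasFDerivAt.mul (hf.hasFDerivAt.inner ℝ hg.hasFDerivAt)
  rw [h.fderiv]
  simp only [_root_.add_apply, FunLike.coe_smul, Pi.smul_apply, smul_eq_mul,
    ContinuousLinearMap.comp_apply, ContinuousLinearMap.prod_apply, fderivInnerCLM_apply]
  ring

/-- Differentiability of a term `c ⟪f, g⟫`. [folklore] -/
theorem differentiableAt_coef_inner {c : Pt d → ℝ} {f g : Pt d → F} {p : Pt d}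
    (hc : DifferentiableAt ℝ c p) (hf : DifferentiableAt ℝ f p) (hg : DifferentiableAt ℝ g p) :
    DifferentiableAt ℝ (fun q ↦ c q * ⟪f q, g q⟫) p :=
  (hc.hasFDerivAt.mul (hf.hasFDerivAt.inner ℝ hg.hasFDerivAt)).differentiableAt

section Identity

variable (ha : ContDiff ℝ ∞ a) (hb : ∀ i, ContDiff ℝ ∞ (b i)) (hG : ∀ i j, ContDiff ℝ ∞ (G i j))
  (hGs : ∀ i j p, G i j p = G j i p) (hu : ContDiff ℝ ∞ u)
include hG hu

include ha in
/-- Derivative of the energy density. [folklore] -/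
theorem fderiv_energy_apply (p v : Pt d) :
    fderiv ℝ (energy u a G) p v =
      2⁻¹ * (fderiv ℝ a p v * ⟪dT u p, dT u p⟫ +
          a p * (⟪fderiv ℝ (dT u) p v, dT u p⟫ + ⟪dT u p, fderiv ℝ (dT u) p v⟫) +
        ∑ i, ∑ j, (fderiv ℝ (G i j) p v * ⟪dX u i p, dX u j p⟫ +
          G i j p * (⟪fderiv ℝ (dX u i) p v, dX u j p⟫ + ⟪dX u i p, fderiv ℝ (dX u j) p v⟫)) +
        (⟪fderiv ℝ u p v, u p⟫ + ⟪u p, fderiv ℝ u p v⟫)) := by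
  have hsm : (∞ : WithTop ℕ∞) ≠ 0 := by simp
  have hTd : DifferentiableAt ℝ (dT u) p := (contDiff_dT hu).differentiable hsm p
  have hXd : ∀ i, DifferentiableAt ℝ (dX u i) p := fun i ↦ (contDiff_dX hu i).differentiable hsm p
  have had : DifferentiableAt ℝ a p := ha.differentiable hsm p
  have hGd : ∀ i j, DifferentiableAt ℝ (G i j) p := fun i j ↦ (hG i j).differentiable hsm p
  have hud : DifferentiableAt ℝ u p := hu.differentiable hsm p
  have h1 : DifferentiableAt ℝ (fun q ↦ a q * ⟪dT u q, dT u q⟫) p :=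
    differentiableAt_coef_inner had hTd hTd
  have h2ij : ∀ i j, DifferentiableAt ℝ (fun q ↦ G i j q * ⟪dX u i q, dX u j q⟫) p := fun i j ↦
    differentiableAt_coef_inner (hGd i j) (hXd i) (hXd j)
  have h2i : ∀ i, DifferentiableAt ℝ (fun q ↦ ∑ j, G i j q * ⟪dX u i q, dX u j q⟫) p := fun i ↦
    DifferentiableAt.fun_sum fun j _ ↦ h2ij i j
  have h2 : DifferentiableAt ℝ (fun q ↦ ∑ i, ∑ j, G i j q * ⟪dX u i q, dX u j q⟫) p :=
    DifferentiableAt.fun_sum fun i _ ↦ h2i i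
  have h3 : DifferentiableAt ℝ (fun q ↦ ⟪u q, u q⟫) p := hud.inner ℝ hud
  have h123 : DifferentiableAt ℝ
      (fun q ↦ a q * ⟪dT u q, dT u q⟫ + ∑ i, ∑ j, G i j q * ⟪dX u i q, dX u j q⟫ + ⟪u q, u q⟫) p :=
    (h1.fun_add h2).fun_add h3
  unfold energy
  rw [fderiv_const_mul h123]
  simp only [FunLike.coe_smul, Pi.smul_apply, smul_eq_mul]
  congr 1
  rw [fderiv_fun_add (h1.fun_add h2) h3, fderiv_fun_add h1 h2]
  simp only [_root_.add_apply]
  rw [fderiv_coef_inner_apply had hTd hTd, fderiv_inner_apply ℝ hud hud,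
    fderiv_fun_sum fun i _ ↦ h2i i]
  simp only [FunLike.coe_sum, Finset.sum_apply]
  congr 1
  · congr 1
    refine Finset.sum_congr rfl fun i _ ↦ ?_
    rw [fderiv_fun_sum fun j _ ↦ h2ij i j]
    simp only [FunLike.coe_sum, Finset.sum_apply]
    exact Finset.sum_congr rfl fun j _ ↦ fderiv_coef_inner_apply (hGd i j) (hXd i) (hXd j) v
  · exact add_comm _ _

include hb in
/-- Derivative of the fluxes. [folklore] -/
theorem fderiv_flux_apply (i : Fin d) (p v : Pt d) :
    fderiv ℝ (flux u b G i) p v =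
      -(∑ j, (fderiv ℝ (G i j) p v * ⟪dT u p, dX u j p⟫ +
          G i j p * (⟪fderiv ℝ (dT u) p v, dX u j p⟫ + ⟪dT u p, fderiv ℝ (dX u j) p v⟫))) -
        (fderiv ℝ (b i) p v * ⟪dT u p, dT u p⟫ +
          b i p * (⟪fderiv ℝ (dT u) p v, dT u p⟫ + ⟪dT u p, fderiv ℝ (dT u) p v⟫)) := by
  have hsm : (∞ : WithTop ℕ∞) ≠ 0 := by simp
  have hTd : DifferentiableAt ℝ (dT u) p := (contDiff_dT hu).differentiable hsm p
  have hXd : ∀ i, DifferentiableAt ℝ (dX u i) p := fun i ↦ (contDiff_dX hu i).differentiable hsm p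
  have hbd : DifferentiableAt ℝ (b i) p := (hb i).differentiable hsm p
  have hGd : ∀ j, DifferentiableAt ℝ (G i j) p := fun j ↦ (hG i j).differentiable hsm p
  have h1j : ∀ j, DifferentiableAt ℝ (fun q ↦ G i j q * ⟪dT u q, dX u j q⟫) p := fun j ↦
    differentiableAt_coef_inner (hGd j) hTd (hXd j)
  have h1 : DifferentiableAt ℝ (fun q ↦ ∑ j, G i j q * ⟪dT u q, dX u j q⟫) p :=
    DifferentiableAt.fun_sum fun j _ ↦ h1j j
  have h2 : DifferentiableAt ℝ (fun q ↦ b i q * ⟪dT u q, dT u q⟫) p :=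
    differentiableAt_coef_inner hbd hTd hTd
  unfold flux
  rw [fderiv_fun_sub h1.fun_neg h2, fderiv_fun_neg]
  simp only [_root_.sub_apply, _root_.neg_apply]
  rw [fderiv_fun_sum fun j _ ↦ h1j j, fderiv_coef_inner_apply hbd hTd hTd]
  simp only [FunLike.coe_sum, Finset.sum_apply]
  congr 2
  exact Finset.sum_congr rfl fun j _ ↦ fderiv_coef_inner_apply (hGd j) hTd (hXd j) v

include ha hb hGs in
/-- **The energy identity** `∂ₜ e + ∑ᵢ ∂ᵢ fᵢ = ⟪u_t, P u⟫ + R`.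
[cite: HawkingEllis1973CUP, §7.4, Lemma 7.4.4] -/
theorem bulk_eq (p : Pt d) :
    fderiv ℝ (energy u a G) p eT + ∑ i, fderiv ℝ (flux u b G i) p (eX i) =
      ⟪dT u p, op u a b G p⟫ + rem u a b G p := by
  rw [fderiv_energy_apply ha hG hu]
  simp only [fderiv_flux_apply hb hG hu, fderiv_dX_eT hu]
  -- name the atoms
  have hTT : fderiv ℝ (dT u) p eT = dTT u p := rfl
  have hTX : ∀ i, fderiv ℝ (dT u) p (eX i) = dTX u i p := fun i ↦ rfl
  have hXX : ∀ i j, fderiv ℝ (dX u j) p (eX i) = dXX u i j p := fun i j ↦ rfl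
  have hut : fderiv ℝ u p eT = dT u p := rfl
  have e3 : ⟪dT u p, u p⟫ = ⟪u p, dT u p⟫ := real_inner_comm _ _
  have e4 : ∀ i, ⟪dTX u i p, dT u p⟫ = ⟪dT u p, dTX u i p⟫ := fun i ↦ real_inner_comm _ _
  have e5 : ⟪dTT u p, dT u p⟫ = ⟪dT u p, dTT u p⟫ := real_inner_comm _ _
  -- the `G ⟪u_i, u_tj⟫` terms: symmetrise
  have e1 : ∑ i, ∑ j, G i j p * ⟪dX u i p, dTX u j p⟫ =
      ∑ i, ∑ j, G i j p * ⟪dTX u i p, dX u j p⟫ := by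
    rw [Finset.sum_comm]
    refine Finset.sum_congr rfl fun i _ ↦ Finset.sum_congr rfl fun j _ ↦ ?_
    rw [hGs j i, real_inner_comm]
  simp only [hTT, hTX, hXX, hut, e3, e4, e5]
  unfold op rem
  simp only [inner_sub_right, real_inner_smul_right, inner_sum, mul_add,
    Finset.sum_add_distrib, Finset.sum_sub_distrib, Finset.sum_neg_distrib]
  linarith [e1]

end Identity

/-! ### Smoothness of energy and fluxes -/

/-- The energy density is smooth. [folklore] -/
theorem contDiff_energy (ha : ContDiff ℝ ∞ a) (hG : ∀ i j, ContDiff ℝ ∞ (G i j))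
    (hu : ContDiff ℝ ∞ u) : ContDiff ℝ ∞ (energy u a G) := by
  unfold energy
  exact contDiff_const.mul (((ha.mul ((contDiff_dT hu).inner ℝ (contDiff_dT hu))).add
    (ContDiff.sum fun i _ ↦ ContDiff.sum fun j _ ↦
      (hG i j).mul ((contDiff_dX hu i).inner ℝ (contDiff_dX hu j)))).add (hu.inner ℝ hu))

/-- The fluxes are smooth. [folklore] -/
theorem contDiff_flux (hb : ∀ i, ContDiff ℝ ∞ (b i)) (hG : ∀ i j, ContDiff ℝ ∞ (G i j))
    (hu : ContDiff ℝ ∞ u) (i : Fin d) : ContDiff ℝ ∞ (flux u b G i) := by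
  unfold flux
  exact (ContDiff.sum fun j _ ↦
    (hG i j).mul ((contDiff_dT hu).inner ℝ (contDiff_dX hu j))).neg.sub
      ((hb i).mul ((contDiff_dT hu).inner ℝ (contDiff_dT hu)))

/-! ### Pointwise estimates -/

section Estimates

omit [InnerProductSpace ℝ F] in
/-- `∑ⱼ ‖x‖ ‖Yⱼ‖ ≤ d ‖x‖² + ∑ⱼ ‖Yⱼ‖²`. [folklore] -/
theorem sum_norm_mul_norm_le (x : F) (Y : Fin d → F) :
    ∑ j, ‖x‖ * ‖Y j‖ ≤ d * ‖x‖ ^ 2 + ∑ j, ‖Y j‖ ^ 2 := by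
  have h : ∀ j, ‖x‖ * ‖Y j‖ ≤ ‖x‖ ^ 2 + ‖Y j‖ ^ 2 := fun j ↦ by
    nlinarith [sq_nonneg (‖x‖ - ‖Y j‖)]
  calc ∑ j, ‖x‖ * ‖Y j‖ ≤ ∑ j, (‖x‖ ^ 2 + ‖Y j‖ ^ 2) := Finset.sum_le_sum fun j _ ↦ h j
    _ = d * ‖x‖ ^ 2 + ∑ j, ‖Y j‖ ^ 2 := by
      rw [Finset.sum_add_distrib, Finset.sum_const, Finset.card_univ, Fintype.card_fin, nsmul_eq_mul]

omit [InnerProductSpace ℝ F] in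
/-- `∑ᵢⱼ ‖Yᵢ‖ ‖Yⱼ‖ ≤ 2 d ∑ⱼ ‖Yⱼ‖²`. [folklore] -/
theorem sum_sum_norm_mul_norm_le (Y : Fin d → F) :
    ∑ i, ∑ j, ‖Y i‖ * ‖Y j‖ ≤ 2 * d * ∑ j, ‖Y j‖ ^ 2 := by
  calc ∑ i, ∑ j, ‖Y i‖ * ‖Y j‖ ≤ ∑ i, (d * ‖Y i‖ ^ 2 + ∑ j, ‖Y j‖ ^ 2) :=
        Finset.sum_le_sum fun i _ ↦ sum_norm_mul_norm_le (Y i) Y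
    _ = 2 * d * ∑ j, ‖Y j‖ ^ 2 := by
      rw [Finset.sum_add_distrib, Finset.sum_const, Finset.card_univ, Fintype.card_fin, nsmul_eq_mul,
        ← Finset.mul_sum]
      ring

/-- `|∑ᵢⱼ cᵢⱼ ⟪Aᵢ, Bⱼ⟫| ≤ Λ ∑ᵢⱼ ‖Aᵢ‖ ‖Bⱼ‖` when `|cᵢⱼ| ≤ Λ`. [folklore] -/
theorem abs_sum_sum_mul_inner_le {c : Fin d → Fin d → ℝ} {Λ : ℝ} (hc : ∀ i j, |c i j| ≤ Λ)
    (A B : Fin d → F) :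
    |∑ i, ∑ j, c i j * ⟪A i, B j⟫| ≤ Λ * ∑ i, ∑ j, ‖A i‖ * ‖B j‖ := by
  rw [Finset.mul_sum]
  refine (Finset.abs_sum_le_sum_abs _ _).trans (Finset.sum_le_sum fun i _ ↦ ?_)
  rw [Finset.mul_sum]
  refine (Finset.abs_sum_le_sum_abs _ _).trans (Finset.sum_le_sum fun j _ ↦ ?_)
  rw [abs_mul]
  have h1 := abs_real_inner_le_norm (A i) (B j)
  have h2 := hc i j
  have h3 : 0 ≤ |c i j| := abs_nonneg _
  have h4 : 0 ≤ |⟪A i, B j⟫| := abs_nonneg _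
  calc |c i j| * |⟪A i, B j⟫| ≤ Λ * (‖A i‖ * ‖B j‖) :=
        mul_le_mul h2 h1 h4 (h3.trans h2)
    _ = Λ * (‖A i‖ * ‖B j‖) := rfl

/-- Coordinates are bounded by the Euclidean norm. [folklore] -/
theorem abs_apply_le_norm (ν : EuclideanSpace ℝ (Fin d)) (i : Fin d) : |ν i| ≤ ‖ν‖ := by
  rw [EuclideanSpace.norm_eq, ← Real.sqrt_sq_eq_abs]
  refine Real.sqrt_le_sqrt ?_
  have h : (ν i) ^ 2 = ‖ν i‖ ^ 2 := by simp [Real.norm_eq_abs, sq_abs]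
  rw [h]
  exact Finset.single_le_sum (f := fun j ↦ ‖ν j‖ ^ 2) (fun j _ ↦ sq_nonneg _) (Finset.mem_univ i)

variable (u a b G)

/-- The quadratic size `S = ‖u‖² + ‖u_t‖² + ∑ᵢ ‖u_i‖²` of the `1`-jet. [folklore] -/
def jetSq (p : Pt d) : ℝ := ‖u p‖ ^ 2 + ‖dT u p‖ ^ 2 + ∑ i, ‖dX u i p‖ ^ 2

variable {u a b G}

/-- `S ≥ 0`. [folklore] -/
theorem jetSq_nonneg (p : Pt d) : 0 ≤ jetSq u p := by
  unfold jetSq; positivity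

/-- **Cone condition**: `|∑ νᵢ fᵢ| ≤ Λ d (d + 1) (‖u_t‖² + ∑ ‖u_j‖²)` for `‖ν‖ ≤ 1`, `|G|, |b| ≤ Λ`.
[cite: HawkingEllis1973CUP, §7.4 (dominant energy on `S^{ab}`)] -/
theorem abs_sum_mul_flux_le (p : Pt d) {ν : EuclideanSpace ℝ (Fin d)} (hν : ‖ν‖ ≤ 1) {Λ : ℝ}
    (hΛ : 0 ≤ Λ) (hGb : ∀ i j, |G i j p| ≤ Λ) (hbb : ∀ i, |b i p| ≤ Λ) :
    |∑ i, ν i * flux u b G i p| ≤ Λ * d * (d + 1) * jetSq u p := by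
  set T := dT u p with hT
  set Q : ℝ := ‖T‖ ^ 2 + ∑ j, ‖dX u j p‖ ^ 2 with hQ
  have hQ0 : 0 ≤ Q := by positivity
  have hQS : Q ≤ jetSq u p := by
    unfold jetSq; nlinarith [norm_nonneg (u p)]
  -- each flux
  have hfi : ∀ i, |flux u b G i p| ≤ Λ * (d + 1) * Q := by
    intro i
    unfold flux
    have h1 : |∑ j, G i j p * ⟪T, dX u j p⟫| ≤ Λ * ∑ j, ‖T‖ * ‖dX u j p‖ := by
      rw [Finset.mul_sum]
      refine (Finset.abs_sum_le_sum_abs _ _).trans (Finset.sum_le_sum fun j _ ↦ ?_)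
      rw [abs_mul]
      exact mul_le_mul (hGb i j) (abs_real_inner_le_norm _ _) (abs_nonneg _)
        ((abs_nonneg _).trans (hGb i j))
    have h2 : |b i p * ⟪T, T⟫| ≤ Λ * ‖T‖ ^ 2 := by
      rw [abs_mul, real_inner_self_eq_norm_sq, abs_of_nonneg (sq_nonneg ‖T‖)]
      exact mul_le_mul_of_nonneg_right (hbb i) (sq_nonneg _)
    have h3 := sum_norm_mul_norm_le T (fun j ↦ dX u j p)
    set A := ∑ j, G i j p * ⟪T, dX u j p⟫ with hA
    set B := b i p * ⟪T, T⟫ with hB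
    calc |-A - B| ≤ |A| + |B| := by
          rw [show -A - B = -(A + B) by ring, abs_neg]
          exact abs_add_le A B
      _ ≤ Λ * (d * ‖T‖ ^ 2 + ∑ j, ‖dX u j p‖ ^ 2) + Λ * ‖T‖ ^ 2 := by
          gcongr
          exact h1.trans (mul_le_mul_of_nonneg_left h3 hΛ)
      _ ≤ Λ * (d + 1) * Q := by
          rw [hQ]
          have : 0 ≤ Λ * (d * ∑ j, ‖dX u j p‖ ^ 2) := by positivity
          nlinarith
  have hνi : ∀ i, |ν i| ≤ 1 := fun i ↦ (abs_apply_le_norm ν i).trans hν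
  calc |∑ i, ν i * flux u b G i p| ≤ ∑ i, |ν i * flux u b G i p| := Finset.abs_sum_le_sum_abs _ _
    _ ≤ ∑ i, Λ * (d + 1) * Q := Finset.sum_le_sum fun i _ ↦ by
        rw [abs_mul]
        calc |ν i| * |flux u b G i p| ≤ 1 * (Λ * (d + 1) * Q) :=
              mul_le_mul (hνi i) (hfi i) (abs_nonneg _) zero_le_one
          _ = Λ * (d + 1) * Q := one_mul _
    _ = Λ * d * (d + 1) * Q := by
        rw [Finset.sum_const, Finset.card_univ, Fintype.card_fin, nsmul_eq_mul]; ring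
    _ ≤ Λ * d * (d + 1) * jetSq u p := by
        apply mul_le_mul_of_nonneg_left hQS; positivity

/-- **Remainder bound**: `|R| ≤ (Λ₁ (2d² + 2d + 1) + 1) S` when `|∂a|, |∂b|, |∂G| ≤ Λ₁`. [folklore] -/
theorem abs_rem_le (p : Pt d) {Λ₁ : ℝ} (hΛ₁ : 0 ≤ Λ₁) (ha' : |fderiv ℝ a p eT| ≤ Λ₁)
    (hGt : ∀ i j, |fderiv ℝ (G i j) p eT| ≤ Λ₁) (hGx : ∀ i j, |fderiv ℝ (G i j) p (eX i)| ≤ Λ₁)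
    (hbx : ∀ i, |fderiv ℝ (b i) p (eX i)| ≤ Λ₁) :
    |rem u a b G p| ≤ (Λ₁ * (2 * d ^ 2 + 2 * d + 1) + 1) * jetSq u p := by
  set T := dT u p with hT
  set U := u p with hU
  set SX : ℝ := ∑ j, ‖dX u j p‖ ^ 2 with hSX
  have hSX0 : 0 ≤ SX := by positivity
  have hS : jetSq u p = ‖U‖ ^ 2 + ‖T‖ ^ 2 + SX := rfl
  -- the five terms
  have h1 : |fderiv ℝ a p eT * ⟪T, T⟫| ≤ Λ₁ * ‖T‖ ^ 2 := by
    rw [abs_mul, real_inner_self_eq_norm_sq, abs_of_nonneg (sq_nonneg ‖T‖)]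
    exact mul_le_mul_of_nonneg_right ha' (sq_nonneg _)
  have h2 : |∑ i, ∑ j, fderiv ℝ (G i j) p eT * ⟪dX u i p, dX u j p⟫| ≤ Λ₁ * (2 * d * SX) :=
    (abs_sum_sum_mul_inner_le (fun i j ↦ hGt i j) _ _).trans
      (mul_le_mul_of_nonneg_left (sum_sum_norm_mul_norm_le _) hΛ₁)
  have h3 : |⟪U, T⟫| ≤ ‖U‖ ^ 2 + ‖T‖ ^ 2 :=
    (abs_real_inner_le_norm _ _).trans (by nlinarith [sq_nonneg (‖U‖ - ‖T‖)])
  have h4 : |∑ i, ∑ j, fderiv ℝ (G i j) p (eX i) * ⟪T, dX u j p⟫| ≤ Λ₁ * (d * (d * ‖T‖ ^ 2 + SX)) := by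
    refine (abs_sum_sum_mul_inner_le (fun i j ↦ hGx i j) (fun _ ↦ T) _).trans
      (mul_le_mul_of_nonneg_left ?_ hΛ₁)
    calc ∑ _i : Fin d, ∑ j, ‖T‖ * ‖dX u j p‖ ≤ ∑ _i : Fin d, (d * ‖T‖ ^ 2 + SX) :=
          Finset.sum_le_sum fun i _ ↦ sum_norm_mul_norm_le T _
      _ = d * (d * ‖T‖ ^ 2 + SX) := by
          rw [Finset.sum_const, Finset.card_univ, Fintype.card_fin, nsmul_eq_mul]
  have h5 : |∑ i, fderiv ℝ (b i) p (eX i) * ⟪T, T⟫| ≤ d * (Λ₁ * ‖T‖ ^ 2) := by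
    refine (Finset.abs_sum_le_sum_abs _ _).trans ?_
    calc ∑ i, |fderiv ℝ (b i) p (eX i) * ⟪T, T⟫| ≤ ∑ _i : Fin d, Λ₁ * ‖T‖ ^ 2 :=
          Finset.sum_le_sum fun i _ ↦ by
            rw [abs_mul, real_inner_self_eq_norm_sq, abs_of_nonneg (sq_nonneg ‖T‖)]
            exact mul_le_mul_of_nonneg_right (hbx i) (sq_nonneg _)
      _ = d * (Λ₁ * ‖T‖ ^ 2) := by
          rw [Finset.sum_const, Finset.card_univ, Fintype.card_fin, nsmul_eq_mul]
  -- combine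
  unfold rem
  have hd : (0 : ℝ) ≤ d := Nat.cast_nonneg d
  have hT0 : 0 ≤ ‖T‖ ^ 2 := sq_nonneg _
  have hU0 : 0 ≤ ‖U‖ ^ 2 := sq_nonneg _
  calc |2⁻¹ * (fderiv ℝ a p eT * ⟪T, T⟫ + ∑ i, ∑ j, fderiv ℝ (G i j) p eT * ⟪dX u i p, dX u j p⟫) +
          ⟪U, T⟫ - ∑ i, ∑ j, fderiv ℝ (G i j) p (eX i) * ⟪T, dX u j p⟫ -
          ∑ i, fderiv ℝ (b i) p (eX i) * ⟪T, T⟫|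
      ≤ 2⁻¹ * (Λ₁ * ‖T‖ ^ 2 + Λ₁ * (2 * d * SX)) + (‖U‖ ^ 2 + ‖T‖ ^ 2) +
          Λ₁ * (d * (d * ‖T‖ ^ 2 + SX)) + d * (Λ₁ * ‖T‖ ^ 2) := by
        refine (abs_sub _ _).trans (add_le_add ((abs_sub _ _).trans (add_le_add
          ((abs_add_le _ _).trans (add_le_add ?_ h3)) h4)) h5)
        rw [abs_mul, abs_of_pos (by norm_num : (0 : ℝ) < 2⁻¹)]
        exact mul_le_mul_of_nonneg_left ((abs_add_le _ _).trans (add_le_add h1 h2)) (by norm_num)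
    _ ≤ (Λ₁ * (2 * d ^ 2 + 2 * d + 1) + 1) * jetSq u p := by
        rw [hS]
        nlinarith [mul_nonneg hΛ₁ hT0, mul_nonneg hΛ₁ hU0, mul_nonneg hΛ₁ hSX0,
          mul_nonneg (mul_nonneg hΛ₁ hd) hT0, mul_nonneg (mul_nonneg hΛ₁ hd) hSX0,
          mul_nonneg (mul_nonneg hΛ₁ hd) hU0,
          mul_nonneg (mul_nonneg (mul_nonneg hΛ₁ hd) hd) hSX0,
          mul_nonneg (mul_nonneg (mul_nonneg hΛ₁ hd) hd) hU0]

/-- **Source bound**: `⟪u_t, P u⟫ ≤ L (d + 2) S` when `‖P u‖ ≤ L (‖u‖ + ‖u_t‖ + ∑ ‖u_i‖)`.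
[folklore] -/
theorem inner_op_le (p : Pt d) {L : ℝ} (hL : 0 ≤ L)
    (hP : ‖op u a b G p‖ ≤ L * (‖u p‖ + ‖dT u p‖ + ∑ i, ‖dX u i p‖)) :
    ⟪dT u p, op u a b G p⟫ ≤ L * (d + 2) * jetSq u p := by
  set T := dT u p with hT
  set U := u p with hU
  have h1 : ⟪T, op u a b G p⟫ ≤ ‖T‖ * (L * (‖U‖ + ‖T‖ + ∑ i, ‖dX u i p‖)) :=
    (real_inner_le_norm _ _).trans (mul_le_mul_of_nonneg_left hP (norm_nonneg _))
  have h2 := sum_norm_mul_norm_le T (fun i ↦ dX u i p)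
  have h3 : ‖T‖ * ‖U‖ ≤ ‖T‖ ^ 2 + ‖U‖ ^ 2 := by nlinarith [sq_nonneg (‖U‖ - ‖T‖)]
  have hd : (0 : ℝ) ≤ d := Nat.cast_nonneg d
  have hSX0 : 0 ≤ ∑ j, ‖dX u j p‖ ^ 2 := by positivity
  refine h1.trans ?_
  rw [show ‖T‖ * (L * (‖U‖ + ‖T‖ + ∑ i, ‖dX u i p‖)) =
      L * (‖T‖ * ‖U‖ + ‖T‖ ^ 2 + ∑ i, ‖T‖ * ‖dX u i p‖) by rw [← Finset.mul_sum]; ring]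
  unfold jetSq
  nlinarith [mul_nonneg hL (sq_nonneg ‖T‖), mul_nonneg hL (sq_nonneg ‖U‖), mul_nonneg hL hSX0,
    mul_nonneg (mul_nonneg hL hd) (sq_nonneg ‖U‖), mul_nonneg (mul_nonneg hL hd) hSX0,
    mul_nonneg (mul_nonneg hL hd) (sq_nonneg ‖T‖)]

/-- **Energy lower bound**: `½ min(λ, 1) S ≤ e` when `a ≥ λ` and `G ≥ λ`. [folklore] -/
theorem jetSq_le_energy (p : Pt d) {lam : ℝ} (hap : lam ≤ a p)
    (hGp : ∀ X : Fin d → F, lam * ∑ i, ‖X i‖ ^ 2 ≤ ∑ i, ∑ j, G i j p * ⟪X i, X j⟫) :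
    2⁻¹ * min lam 1 * jetSq u p ≤ energy u a G p := by
  unfold energy jetSq
  have h1 := hGp fun i ↦ dX u i p
  rw [real_inner_self_eq_norm_sq, real_inner_self_eq_norm_sq]
  have hm1 := min_le_left lam 1
  have hm2 := min_le_right lam 1
  have hT0 := sq_nonneg ‖dT u p‖
  have hU0 := sq_nonneg ‖u p‖
  have hSX0 : 0 ≤ ∑ j, ‖dX u j p‖ ^ 2 := by positivity
  nlinarith [mul_le_mul_of_nonneg_right hap hT0, mul_le_mul_of_nonneg_right hm1 hT0,
    mul_le_mul_of_nonneg_right hm1 hSX0, mul_le_mul_of_nonneg_right hm2 hU0]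

end Estimates

/-! ### Vanishing of the spatial derivatives of vanishing data -/

/-- If `u(0, ·) = 0` on `B̄(x₁, ρ)`, `ρ > 0`, then `u_i(0, ·) = 0` there. [folklore] -/
theorem dX_zero_of_data (hu : ContDiff ℝ ∞ u) {x₁ : EuclideanSpace ℝ (Fin d)} {ρ : ℝ} (hρ : 0 < ρ)
    (h0 : ∀ x ∈ closedBall x₁ ρ, u (0, x) = 0) (i : Fin d) {x : EuclideanSpace ℝ (Fin d)}
    (hx : x ∈ closedBall x₁ ρ) : dX u i (0, x) = 0 := by
  -- on the open ball: differentiate the slice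
  have hball : ∀ y ∈ ball x₁ ρ, dX u i (0, y) = 0 := by
    intro y hy
    have hs : HasFDerivAt (fun z : EuclideanSpace ℝ (Fin d) ↦ u ((0 : ℝ), z))
        ((fderiv ℝ u ((0 : ℝ), y)).comp (ContinuousLinearMap.inr ℝ ℝ (EuclideanSpace ℝ (Fin d)))) y := by
      have h1 : HasFDerivAt u (fderiv ℝ u ((0 : ℝ), y)) ((0 : ℝ), y) :=
        ((hu.differentiable (by simp)) _).hasFDerivAt
      exact h1.comp y ((hasFDerivAt_const (0 : ℝ) y).prodMk (hasFDerivAt_id y))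
    have hzero : fderiv ℝ (fun z : EuclideanSpace ℝ (Fin d) ↦ u ((0 : ℝ), z)) y = 0 := by
      have hev : (fun z : EuclideanSpace ℝ (Fin d) ↦ u ((0 : ℝ), z)) =ᶠ[𝓝 y] fun _ ↦ 0 :=
        Filter.eventually_of_mem (isOpen_ball.mem_nhds hy) fun z hz ↦ h0 z (ball_subset_closedBall hz)
      rw [hev.fderiv_eq, fderiv_fun_const]; rfl
    have h := congrArg (fun L : EuclideanSpace ℝ (Fin d) →L[ℝ] F ↦ L (EuclideanSpace.single i (1 : ℝ)))
      (hs.fderiv.symm.trans hzero)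
    simpa [dX] using h
  -- on the closed ball by continuity
  have hcont : Continuous fun y : EuclideanSpace ℝ (Fin d) ↦ dX u i ((0 : ℝ), y) :=
    (contDiff_dX hu i).continuous.comp (continuous_const.prodMk continuous_id)
  have hcl : closedBall x₁ ρ ⊆ closure (ball x₁ ρ) := by rw [closure_ball x₁ hρ.ne']
  exact (isClosed_eq hcont continuous_const).closure_subset_iff.2 hball (hcl hx)

/-! ### The theorem -/

/-- **Uniqueness in the domain of dependence (variable coefficients, systems).** Let
`a, bⁱ, Gⁱʲ = Gʲⁱ` be smooth on `ℝ × ℝᵈ`, and on the cylinder `Z = [0, T] × B̄(x₁, ρ)` let `a ≥ λ` and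
`∑ Gⁱʲ ⟪Xᵢ, Xⱼ⟫ ≥ λ ∑ ‖Xᵢ‖²` (`λ > 0`). Then there is a slope `c > 0` (depending only on the
coefficients on `Z` and `λ`) such that every smooth `u : ℝ × ℝᵈ → F` with
`‖a u_tt − 2 ∑ bⁱ u_ti − ∑ Gⁱʲ u_ij‖ ≤ L (‖u‖ + ‖u_t‖ + ∑ ‖u_i‖)` on `Z` (any `L`) and
`u(0, ·) = u_t(0, ·) = 0` on `B̄(x₁, ρ)` vanishes at every `(t, x)` with `0 ≤ t ≤ T`,
`dist(x, x₁) < ρ − c t`. (Hawking–Ellis prove uniqueness for the second-order hyperbolic equation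
(7.29) from the energy inequality of Lemma 7.4.4 on the regions `𝒰₊` — Prop. 7.4.5 / Lemma 7.4.6 —
and apply the same mechanism to the difference of two solutions of the quasilinear reduced
Einstein equations, Prop. 7.5.1; the classical cone form is John, Ch. 5 §3, Racke, Thm. 3.1.)
[cite: HawkingEllis1973CUP, §7.4, Prop. 7.4.5 and Lemma 7.4.6; §7.5, Prop. 7.5.1]
[cite: John1982, Ch. 5 §3] -/
theorem exists_slope_eq_zero_of_norm_le (ha : ContDiff ℝ ∞ a) (hb : ∀ i, ContDiff ℝ ∞ (b i))
    (hG : ∀ i j, ContDiff ℝ ∞ (G i j)) (hGs : ∀ i j p, G i j p = G j i p)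
    {T ρ lam : ℝ} {x₁ : EuclideanSpace ℝ (Fin d)} (hlam : 0 < lam)
    (hapos : ∀ p ∈ Icc 0 T ×ˢ closedBall x₁ ρ, lam ≤ a p)
    (hGpos : ∀ p ∈ Icc 0 T ×ˢ closedBall x₁ ρ, ∀ X : Fin d → F,
      lam * ∑ i, ‖X i‖ ^ 2 ≤ ∑ i, ∑ j, G i j p * ⟪X i, X j⟫) :
    ∃ c : ℝ, 0 < c ∧ ∀ (L : ℝ) (u : Pt d → F), ContDiff ℝ ∞ u →
      (∀ p ∈ Icc 0 T ×ˢ closedBall x₁ ρ,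
        ‖op u a b G p‖ ≤ L * (‖u p‖ + ‖dT u p‖ + ∑ i, ‖dX u i p‖)) →
      (∀ x ∈ closedBall x₁ ρ, u (0, x) = 0) → (∀ x ∈ closedBall x₁ ρ, dT u (0, x) = 0) →
      ∀ t ∈ Icc 0 T, ∀ x, dist x x₁ < ρ - c * t → u (t, x) = 0 := by
  set Z : Set (Pt d) := Icc 0 T ×ˢ closedBall x₁ ρ with hZ
  have hZc : IsCompact Z := isCompact_Icc.prod (isCompact_closedBall x₁ ρ)
  have hsm : (∞ : WithTop ℕ∞) ≠ 0 := by simp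
  -- bounds for the coefficients and their first derivatives on `Z`
  set Φ₀ : Pt d → ℝ := fun p ↦ ∑ i, ∑ j, |G i j p| + ∑ i, |b i p| with hΦ₀
  have hΦ₀c : Continuous Φ₀ :=
    (continuous_finsetSum _ fun i _ ↦ continuous_finsetSum _ fun j _ ↦
      ((hG i j).continuous).abs).add (continuous_finsetSum _ fun i _ ↦ ((hb i).continuous).abs)
  obtain ⟨Λ', hΛ'⟩ := hZc.exists_bound_of_continuousOn hΦ₀c.continuousOn
  set Λ := max Λ' 0 with hΛdef
  have hΛnn : 0 ≤ Λ := le_max_right _ _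
  have hΦ₀nn : ∀ p, 0 ≤ Φ₀ p := fun p ↦ by positivity
  have hΦ₀le : ∀ p ∈ Z, Φ₀ p ≤ Λ := fun p hp ↦ by
    have h := hΛ' p hp
    rw [Real.norm_of_nonneg (hΦ₀nn p)] at h
    exact h.trans (le_max_left _ _)
  have hGb : ∀ p ∈ Z, ∀ i j, |G i j p| ≤ Λ := fun p hp i j ↦ by
    refine le_trans ?_ (hΦ₀le p hp)
    have h1 : |G i j p| ≤ ∑ j, |G i j p| :=
      Finset.single_le_sum (f := fun j ↦ |G i j p|) (fun _ _ ↦ abs_nonneg _) (Finset.mem_univ j)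
    have h2 : ∑ j, |G i j p| ≤ ∑ i, ∑ j, |G i j p| :=
      Finset.single_le_sum (f := fun i ↦ ∑ j, |G i j p|) (fun _ _ ↦ by positivity) (Finset.mem_univ i)
    have h3 : 0 ≤ ∑ i, |b i p| := by positivity
    simp only [hΦ₀]; linarith
  have hbb : ∀ p ∈ Z, ∀ i, |b i p| ≤ Λ := fun p hp i ↦ by
    refine le_trans ?_ (hΦ₀le p hp)
    have h1 : |b i p| ≤ ∑ i, |b i p| :=
      Finset.single_le_sum (f := fun i ↦ |b i p|) (fun _ _ ↦ abs_nonneg _) (Finset.mem_univ i)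
    have h3 : 0 ≤ ∑ i, ∑ j, |G i j p| := by positivity
    simp only [hΦ₀]; linarith
  set Φ₁ : Pt d → ℝ := fun p ↦ |fderiv ℝ a p eT| + ∑ i, ∑ j, (|fderiv ℝ (G i j) p eT| +
      |fderiv ℝ (G i j) p (eX i)|) + ∑ i, |fderiv ℝ (b i) p (eX i)| with hΦ₁
  have hdc : ∀ {f : Pt d → ℝ}, ContDiff ℝ ∞ f → ∀ v, Continuous fun p ↦ |fderiv ℝ f p v| :=
    fun hf v ↦ ((hf.continuous_fderiv (by simp)).clm_apply continuous_const).abs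
  have hΦ₁c : Continuous Φ₁ :=
    ((hdc ha _).add (continuous_finsetSum _ fun i _ ↦ continuous_finsetSum _ fun j _ ↦
      (hdc (hG i j) _).add (hdc (hG i j) _))).add (continuous_finsetSum _ fun i _ ↦ hdc (hb i) _)
  obtain ⟨Λ₁', hΛ₁'⟩ := hZc.exists_bound_of_continuousOn hΦ₁c.continuousOn
  set Λ₁ := max Λ₁' 0 with hΛ₁def
  have hΛ₁ : 0 ≤ Λ₁ := le_max_right _ _
  have hΦ₁nn : ∀ p, 0 ≤ Φ₁ p := fun p ↦ by positivity
  have hΦ₁le : ∀ p ∈ Z, Φ₁ p ≤ Λ₁ := fun p hp ↦ by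
    have h := hΛ₁' p hp
    rw [Real.norm_of_nonneg (hΦ₁nn p)] at h
    exact h.trans (le_max_left _ _)
  have hderivs : ∀ p ∈ Z, |fderiv ℝ a p eT| ≤ Λ₁ ∧ (∀ i j, |fderiv ℝ (G i j) p eT| ≤ Λ₁) ∧
      (∀ i j, |fderiv ℝ (G i j) p (eX i)| ≤ Λ₁) ∧ ∀ i, |fderiv ℝ (b i) p (eX i)| ≤ Λ₁ := by
    intro p hp
    have h := hΦ₁le p hp
    have hA : 0 ≤ |fderiv ℝ a p eT| := abs_nonneg _
    have hS1 : ∀ i j, |fderiv ℝ (G i j) p eT| + |fderiv ℝ (G i j) p (eX i)| ≤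
        ∑ i, ∑ j, (|fderiv ℝ (G i j) p eT| + |fderiv ℝ (G i j) p (eX i)|) := fun i j ↦
      (Finset.single_le_sum (f := fun j ↦ |fderiv ℝ (G i j) p eT| + |fderiv ℝ (G i j) p (eX i)|)
        (fun _ _ ↦ by positivity) (Finset.mem_univ j)).trans
        (Finset.single_le_sum (f := fun i ↦ ∑ j, (|fderiv ℝ (G i j) p eT| +
          |fderiv ℝ (G i j) p (eX i)|)) (fun _ _ ↦ by positivity) (Finset.mem_univ i))
    have hS1nn : 0 ≤ ∑ i, ∑ j, (|fderiv ℝ (G i j) p eT| + |fderiv ℝ (G i j) p (eX i)|) := by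
      positivity
    have hS2 : ∀ i, |fderiv ℝ (b i) p (eX i)| ≤ ∑ i, |fderiv ℝ (b i) p (eX i)| := fun i ↦
      Finset.single_le_sum (f := fun i ↦ |fderiv ℝ (b i) p (eX i)|) (fun _ _ ↦ abs_nonneg _)
        (Finset.mem_univ i)
    have hS2nn : 0 ≤ ∑ i, |fderiv ℝ (b i) p (eX i)| := by positivity
    simp only [hΦ₁] at h
    refine ⟨by linarith, fun i j ↦ ?_, fun i j ↦ ?_, fun i ↦ ?_⟩
    · have := hS1 i j; have := abs_nonneg (fderiv ℝ (G i j) p (eX i)); linarith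
    · have := hS1 i j; have := abs_nonneg (fderiv ℝ (G i j) p eT); linarith
    · have := hS2 i; linarith
  -- constants
  set c₀ : ℝ := 2⁻¹ * min lam 1 with hc₀
  have hc₀pos : 0 < c₀ := by have := lt_min hlam one_pos; positivity
  set K₁ : ℝ := Λ * d * (d + 1) with hK₁
  have hK₁nn : 0 ≤ K₁ := by positivity
  set K₂ : ℝ := Λ₁ * (2 * d ^ 2 + 2 * d + 1) + 1 with hK₂
  have hK₂nn : 0 ≤ K₂ := by positivity
  refine ⟨K₁ / c₀ + 1, by positivity, fun L u hu hP h0 h1 t ht x hx ↦ ?_⟩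
  have hcpos : 0 < K₁ / c₀ + 1 := by positivity
  -- trivial cases: empty ball, initial time
  rcases le_or_gt ρ 0 with hρ | hρ
  · exfalso
    have : 0 ≤ (K₁ / c₀ + 1) * t := mul_nonneg hcpos.le ht.1
    linarith [dist_nonneg (x := x) (y := x₁)]
  have hxball : x ∈ closedBall x₁ ρ := by
    rw [mem_closedBall]
    have : 0 ≤ (K₁ / c₀ + 1) * t := mul_nonneg hcpos.le ht.1
    linarith
  rcases ht.1.eq_or_lt with hzero | htpos
  · rw [← hzero]; exact h0 x hxball
  -- positive time: the energy method on the cone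
  set L' := max L 0 with hL'
  have hL'nn : 0 ≤ L' := le_max_right _ _
  have hP' : ∀ p ∈ Z, ‖op u a b G p‖ ≤ L' * (‖u p‖ + ‖dT u p‖ + ∑ i, ‖dX u i p‖) := fun p hp ↦
    (hP p hp).trans (mul_le_mul_of_nonneg_right (le_max_left _ _) (by positivity))
  have hec := contDiff_energy ha hG hu
  have hfc := contDiff_flux hb hG hu
  obtain ⟨C, hC⟩ := hZc.exists_bound_of_continuousOn
    ((hec.continuous_fderiv (by simp)).continuousOn)
  have henergy : ∀ p ∈ Z, c₀ * jetSq u p ≤ energy u a G p := fun p hp ↦ by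
    have h := jetSq_le_energy (u := u) p (hapos p hp) (hGpos p hp)
    rwa [← hc₀] at h
  have hjet : ∀ p ∈ Z, jetSq u p ≤ energy u a G p / c₀ := fun p hp ↦ by
    rw [le_div_iff₀ hc₀pos, mul_comm]; exact henergy p hp
  set M : ℝ := (L' * (d + 2) + K₂) / c₀ with hM
  have hE : energy u a G (t, x) = 0 := by
    refine Literature.Analysis.FluidPDE.coneEnergy_eq_zero (d := d) (τ := 0) (τ' := T) (ρ := ρ)
      (c := K₁ / c₀ + 1) (M := M) (C := C) (x₁ := x₁) (e := energy u a G) (f := flux u b G)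
      hcpos.le hec.continuous.continuousOn (hec.of_le (by simp)).contDiffOn
      (fun j ↦ ((hfc j).of_le (by simp)).contDiffOn)
      (fun p hp ↦ hC p ⟨Ioo_subset_Icc_self hp.1, hp.2⟩)
      (fun p hp ↦ (mul_nonneg hc₀pos.le (jetSq_nonneg p)).trans (henergy p hp))
      (fun p hp ↦ ?_) (fun p hp ν hν ↦ ?_) (fun y hy ↦ ?_) ⟨htpos, ht.2⟩ (by rw [sub_zero]; exact hx)
    · -- bulk inequality
      have hpZ : p ∈ Z := ⟨Ioo_subset_Icc_self hp.1, hp.2⟩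
      rw [bulk_eq ha hb hG hGs hu p]
      have h1 := inner_op_le p hL'nn (hP' p hpZ)
      obtain ⟨hd1, hd2, hd3, hd4⟩ := hderivs p hpZ
      have h2 := (abs_le.1 (abs_rem_le (u := u) p hΛ₁ hd1 hd2 hd3 hd4)).2
      rw [← hK₂] at h2
      have hcoef : 0 ≤ L' * (d + 2) + K₂ := by positivity
      calc ⟪dT u p, op u a b G p⟫ + rem u a b G p ≤ (L' * (d + 2) + K₂) * jetSq u p := by linarith
        _ ≤ (L' * (d + 2) + K₂) * (energy u a G p / c₀) :=
            mul_le_mul_of_nonneg_left (hjet p hpZ) hcoef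
        _ = M * energy u a G p := by rw [hM]; ring
    · -- cone condition
      have h1 := abs_sum_mul_flux_le (u := u) p hν hΛnn (hGb p hp) (hbb p hp)
      rw [← hK₁] at h1
      have h2 := hjet p hp
      have h3 : 0 ≤ energy u a G p := (mul_nonneg hc₀pos.le (jetSq_nonneg p)).trans (henergy p hp)
      calc |∑ j, ν j * flux u b G j p| ≤ K₁ * jetSq u p := h1
        _ ≤ K₁ * (energy u a G p / c₀) := mul_le_mul_of_nonneg_left h2 hK₁nn
        _ = K₁ / c₀ * energy u a G p := by ring
        _ ≤ (K₁ / c₀ + 1) * energy u a G p := by nlinarith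
    · -- vanishing initial energy
      simp [energy, h0 y hy, h1 y hy, dX_zero_of_data hu hρ h0 _ hy]
  -- conclude
  have hpZ : ((t, x) : Pt d) ∈ Z := ⟨ht, hxball⟩
  have h3 := henergy _ hpZ
  rw [hE] at h3
  have h4 : jetSq u (t, x) ≤ 0 := by
    by_contra h
    push Not at h
    have := mul_pos hc₀pos h
    linarith
  have h5 : ‖u (t, x)‖ ^ 2 ≤ 0 := by
    unfold jetSq at h4
    have : 0 ≤ ∑ i, ‖dX u i (t, x)‖ ^ 2 := by positivity
    nlinarith [sq_nonneg ‖dT u (t, x)‖]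
  have h6 : ‖u (t, x)‖ = 0 := by
    have := le_antisymm h5 (sq_nonneg _)
    exact pow_eq_zero_iff two_ne_zero |>.1 this
  exact norm_eq_zero.1 h6

end VarWave

end Literature.Analysis.PDE
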